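import Mathlib
import Literature.MathematicalPhysics.KineticTheory.PhononPairBand
import HarnessLib

/-!
# Shape of the group velocity of the pinned band — helper file for `stub_slabNonconcentration` (stub NC)
of line `swap-odd-threshold-rigidity` (crux `EmbeddedDrudeMourre.MourreDissolution`, item
stmt-AtomisticToContinuum-12594; helper file, `--supports`)

For `ω₂ > 0` the group velocity `v(k) = sin k/ω(k)`, `ω(k) = √(ω₂ + 2(1 − cos k))`, satisfies
* `v′(k) = ((ω₂+2)cos k − cos²k − 1)/ω³ = (cos k − c₋)(c₊ − cos k)/ω³` with `c₋ = cos κ* ∈ (0,1)`, `c₊ > 1`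
  (`PhononPairBand`: `hasDerivAt_groupVelocity`, `cosKappaStar`, `kappaStar`), hence `v′ > 0` where
  `cos k > c₋` (i.e. on `(−κ*, κ*) + 2πℤ`) and `v′ < 0` where `cos k < c₋`;
* `v` is strictly increasing on `[−κ*, κ*]` and strictly decreasing on `[κ*, 2π − κ*]`, and `κ*` is its
  unique maximiser on `[−π − 1, π + 1]`;
* a GAP lemma at the maximum: for every `d₂ > 0` there are `d₁ > 0`, `γ > 0` with `v(w) + γ ≤ v(u)`
  whenever `|u − κ*| ≤ d₁`, `w ∈ [−π−1, π+1]`, `|w − κ*| ≥ d₂` (and the mirror statement at the minimum `−κ*`);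
* a floor `|v′| ≥ c(d) > 0` on `[−κ* + d, κ* − d]`, `[κ* + d, 2π − κ* − d]`, `[−2π + κ* + d, −κ* − d]`;
* `v″(k) = −sin k·(cos²k − (ω₂+2)cos k + (ω₂+2)² − 3)/ω⁵`, negative on `(0, π)`, with a floor near `κ*`.
Pure calculus; no cited facts.
-/

noncomputable section

namespace Summit.AtomisticToContinuum.FouriersLaw.Theorems.MourreDissolution

open Real Set Filter Topology
open Literature.MathematicalPhysics.KineticTheory.PhononBoltzmann

/-! ### The first derivative in cosine form and its sign -/

/-- `v′(k) = ((ω₂+2)cos k − cos²k − 1)/ω(k)³`. [folklore] -/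
theorem velShape_deriv_eq {ω₂ : ℝ} (hω : 0 < ω₂) (k : ℝ) :
    deriv (groupVelocity ω₂) k = ((ω₂ + 2) * cos k - cos k ^ 2 - 1) / dispersion ω₂ k ^ 3 := by
  rw [(hasDerivAt_groupVelocity hω k).deriv, dispersion_sq hω.le, Real.sin_sq]
  ring

/-- The larger root `c₊ = ((ω₂+2) + √((ω₂+2)² − 4))/2 > 1` of `c² − (ω₂+2)c + 1`. [folklore] -/
theorem velShape_one_lt_cPlus {ω₂ : ℝ} (hω : 0 < ω₂) :
    1 < ((ω₂ + 2) + Real.sqrt ((ω₂ + 2) ^ 2 - 4)) / 2 := by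
  have := Real.sqrt_nonneg ((ω₂ + 2) ^ 2 - 4)
  linarith

/-- Factorisation of the numerator: `(ω₂+2)x − x² − 1 = (x − c₋)(c₊ − x)`. [folklore] -/
theorem velShape_numer_factor {ω₂ : ℝ} (hω : 0 ≤ ω₂) (x : ℝ) :
    (ω₂ + 2) * x - x ^ 2 - 1 =
      (x - cosKappaStar ω₂) * (((ω₂ + 2) + Real.sqrt ((ω₂ + 2) ^ 2 - 4)) / 2 - x) := by
  have hs := Real.sq_sqrt (show (0 : ℝ) ≤ (ω₂ + 2) ^ 2 - 4 by nlinarith)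
  rw [cosKappaStar]
  linear_combination (-(1 / 4 : ℝ)) * hs

/-- `v′(k) > 0` where `cos k > c₋`. [folklore] -/
theorem velShape_deriv_pos_of_cos_gt {ω₂ : ℝ} (hω : 0 < ω₂) {k : ℝ}
    (hk : cosKappaStar ω₂ < cos k) : 0 < deriv (groupVelocity ω₂) k := by
  rw [velShape_deriv_eq hω, velShape_numer_factor hω.le]
  have h1 : cos k < ((ω₂ + 2) + Real.sqrt ((ω₂ + 2) ^ 2 - 4)) / 2 :=
    (cos_le_one k).trans_lt (velShape_one_lt_cPlus hω)
  have h2 : 0 < dispersion ω₂ k ^ 3 := pow_pos (dispersion_pos hω k) 3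
  exact div_pos (mul_pos (sub_pos.2 hk) (sub_pos.2 h1)) h2

/-- `v′(k) < 0` where `cos k < c₋`. [folklore] -/
theorem velShape_deriv_neg_of_cos_lt {ω₂ : ℝ} (hω : 0 < ω₂) {k : ℝ}
    (hk : cos k < cosKappaStar ω₂) : deriv (groupVelocity ω₂) k < 0 := by
  rw [velShape_deriv_eq hω, velShape_numer_factor hω.le]
  have h1 : cos k < ((ω₂ + 2) + Real.sqrt ((ω₂ + 2) ^ 2 - 4)) / 2 :=
    (cos_le_one k).trans_lt (velShape_one_lt_cPlus hω)
  have h2 : 0 < dispersion ω₂ k ^ 3 := pow_pos (dispersion_pos hω k) 3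
  exact div_neg_of_neg_of_pos (mul_neg_of_neg_of_pos (sub_neg.2 hk) (sub_pos.2 h1)) h2

/-- `v′(k) = 0` iff `cos k = c₋` (restated from `deriv_groupVelocity_eq_zero_iff_cos`). [folklore] -/
theorem velShape_deriv_ne_zero_of_cos_ne {ω₂ : ℝ} (hω : 0 < ω₂) {k : ℝ}
    (hk : cos k ≠ cosKappaStar ω₂) : deriv (groupVelocity ω₂) k ≠ 0 := fun h =>
  hk ((deriv_groupVelocity_eq_zero_iff_cos hω k).1 h)

/-! ### Where `cos k` lies above / below `c₋ = cos κ*` -/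

/-- `κ* ∈ (0, π)`. [folklore] -/
theorem velShape_kappaStar_mem {ω₂ : ℝ} (hω : 0 < ω₂) : kappaStar ω₂ ∈ Ioo 0 π :=
  ⟨(kappaStar_mem_Ioo hω).1, (kappaStar_mem_Ioo hω).2.trans (by linarith [pi_pos])⟩

/-- On `(−κ*, κ*)`: `cos k > c₋`. [folklore] -/
theorem velShape_cos_gt_of_abs_lt {ω₂ : ℝ} (hω : 0 < ω₂) {k : ℝ} (hk : |k| < kappaStar ω₂) :
    cosKappaStar ω₂ < cos k := by
  have hκ := velShape_kappaStar_mem hω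
  rw [← cos_kappaStar hω, ← Real.cos_abs k]
  exact cos_lt_cos_of_nonneg_of_le_pi (abs_nonneg k) hκ.2.le hk

/-- On `(κ*, 2π − κ*)`: `cos k < c₋`. [folklore] -/
theorem velShape_cos_lt_of_mem {ω₂ : ℝ} (hω : 0 < ω₂) {k : ℝ}
    (hk : k ∈ Ioo (kappaStar ω₂) (2 * π - kappaStar ω₂)) : cos k < cosKappaStar ω₂ := by
  have hκ := velShape_kappaStar_mem hω
  rw [← cos_kappaStar hω]
  rcases le_or_gt k π with h | h
  · exact cos_lt_cos_of_nonneg_of_le_pi hκ.1.le h hk.1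
  · -- reflect: cos k = cos (2π − k) with 2π − k ∈ (κ*, π)
    rw [← Real.cos_two_pi_sub]
    exact cos_lt_cos_of_nonneg_of_le_pi hκ.1.le (by linarith) (by linarith [hk.2])

/-! ### Monotonicity on the two arcs and the unique maximum -/

/-- The group velocity is continuous. [folklore] -/
theorem velShape_continuous (ω₂ : ℝ) (hω : 0 < ω₂) : Continuous (groupVelocity ω₂) :=
  continuous_iff_continuousAt.2 fun k => (hasDerivAt_groupVelocity hω k).continuousAt

/-- `v` is strictly increasing on `[−κ*, κ*]`. [folklore] -/
theorem velShape_strictMonoOn {ω₂ : ℝ} (hω : 0 < ω₂) :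
    StrictMonoOn (groupVelocity ω₂) (Icc (-kappaStar ω₂) (kappaStar ω₂)) := by
  refine strictMonoOn_of_deriv_pos (convex_Icc _ _) (velShape_continuous ω₂ hω).continuousOn ?_
  intro k hk
  rw [interior_Icc] at hk
  exact velShape_deriv_pos_of_cos_gt hω (velShape_cos_gt_of_abs_lt hω (abs_lt.2 hk))

/-- `v` is strictly decreasing on `[κ*, 2π − κ*]`. [folklore] -/
theorem velShape_strictAntiOn {ω₂ : ℝ} (hω : 0 < ω₂) :
    StrictAntiOn (groupVelocity ω₂) (Icc (kappaStar ω₂) (2 * π - kappaStar ω₂)) := by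
  refine strictAntiOn_of_deriv_neg (convex_Icc _ _) (velShape_continuous ω₂ hω).continuousOn ?_
  intro k hk
  rw [interior_Icc] at hk
  exact velShape_deriv_neg_of_cos_lt hω (velShape_cos_lt_of_mem hω hk)

/-- `v(κ*) > 0`. [folklore] -/
theorem velShape_pos_kappaStar {ω₂ : ℝ} (hω : 0 < ω₂) : 0 < groupVelocity ω₂ (kappaStar ω₂) := by
  have hκ := velShape_kappaStar_mem hω
  exact div_pos (sin_pos_of_pos_of_lt_pi hκ.1 hκ.2) (dispersion_pos hω _)

/-- `κ*` is the unique maximiser of `v` on `[−π − 1, π + 1]`: `v(w) < v(κ*)` for `w ≠ κ*` there.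
[folklore] -/
theorem velShape_lt_max {ω₂ : ℝ} (hω : 0 < ω₂) {w : ℝ} (hw : w ∈ Icc (-π - 1) (π + 1))
    (hne : w ≠ kappaStar ω₂) : groupVelocity ω₂ w < groupVelocity ω₂ (kappaStar ω₂) := by
  have hκ := velShape_kappaStar_mem hω
  have hκ2 := (kappaStar_mem_Ioo hω).2
  have hpi : 3 < π := pi_gt_three
  rcases lt_or_gt_of_ne hne with hlt | hgt
  · rcases le_or_gt (-kappaStar ω₂) w with h1 | h1
    · -- `w ∈ [−κ*, κ*)`: strict increase
      exact velShape_strictMonoOn hω ⟨h1, hlt.le⟩ ⟨by linarith, le_rfl⟩ hlt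
    · -- `w ∈ [−π−1, −κ*)`: shift by `2π` into `(κ*, 2π − κ*]`, strict decrease
      have hp : groupVelocity ω₂ w = groupVelocity ω₂ (w + 2 * π) :=
        ((groupVelocity_periodic ω₂) w).symm
      rw [hp]
      have hmem : w + 2 * π ∈ Icc (kappaStar ω₂) (2 * π - kappaStar ω₂) :=
        ⟨by linarith [hw.1], by linarith⟩
      exact velShape_strictAntiOn hω ⟨le_rfl, by linarith⟩ hmem (by linarith [hw.1])
  · -- `w ∈ (κ*, π + 1] ⊆ (κ*, 2π − κ*]`: strict decrease
    have hmem : w ∈ Icc (kappaStar ω₂) (2 * π - kappaStar ω₂) := ⟨hgt.le, by linarith [hw.2]⟩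
    exact velShape_strictAntiOn hω ⟨le_rfl, by linarith⟩ hmem hgt


/-! ### The gap at the maximum `κ*` and at the minimum `−κ*` -/

/-- **Gap at the maximum.** For every `d₂ > 0` there are `d₁ > 0` and `γ > 0` such that
`v(w) + γ ≤ v(u)` whenever `|u − κ*| ≤ d₁`, `w ∈ [−π−1, π+1]` and `d₂ ≤ |w − κ*|`. [folklore] -/
theorem velShape_gap_max {ω₂ : ℝ} (hω : 0 < ω₂) {d₂ : ℝ} (hd₂ : 0 < d₂) :
    ∃ d₁ : ℝ, 0 < d₁ ∧ ∃ γ : ℝ, 0 < γ ∧ ∀ u w : ℝ, |u - kappaStar ω₂| ≤ d₁ →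
      w ∈ Icc (-π - 1) (π + 1) → d₂ ≤ |w - kappaStar ω₂| →
      groupVelocity ω₂ w + γ ≤ groupVelocity ω₂ u := by
  set v := groupVelocity ω₂ with hv
  set κ := kappaStar ω₂ with hκdef
  have hκ := velShape_kappaStar_mem hω
  have hcont := velShape_continuous ω₂ hω
  -- the far set is compact and (if nonempty) `v` attains its maximum there, strictly below `v κ`
  set F : Set ℝ := Icc (-π - 1) (π + 1) ∩ {w | d₂ ≤ |w - κ|} with hF
  have hFc : IsCompact F :=
    isCompact_Icc.inter_right (isClosed_le continuous_const (continuous_abs.comp (continuous_sub_right κ)))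
  by_cases hFne : F.Nonempty
  · obtain ⟨w₀, hw₀F, hw₀max⟩ := hFc.exists_isMaxOn hFne hcont.continuousOn
    have hw₀ne : w₀ ≠ κ := by
      intro h
      have := hw₀F.2
      simp only [mem_setOf_eq, h, sub_self, abs_zero] at this
      linarith
    have hlt : v w₀ < v κ := velShape_lt_max hω hw₀F.1 hw₀ne
    set γ := (v κ - v w₀) / 2 with hγ
    have hγpos : 0 < γ := by rw [hγ]; linarith
    -- continuity of `v` at `κ`
    have hc : ∀ᶠ u in 𝓝 κ, v κ - γ < v u := by
      have := hcont.continuousAt (x := κ)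
      exact this.eventually (lt_mem_nhds (by linarith))
    obtain ⟨d₁, hd₁, hball⟩ := Metric.eventually_nhds_iff.1 hc
    refine ⟨d₁ / 2, by linarith, γ, hγpos, fun u w hu hw hfar => ?_⟩
    have hu' : v κ - γ < v u := hball (by rw [Real.dist_eq]; linarith [abs_nonneg (u - κ)])
    have hwle : v w ≤ v w₀ := hw₀max ⟨hw, hfar⟩
    linarith
  · -- empty far set: the statement is vacuous
    refine ⟨1, one_pos, 1, one_pos, fun u w _ hw hfar => ?_⟩
    exact absurd ⟨w, hw, hfar⟩ hFne

/-- **Gap at the minimum** (mirror image under `k ↦ −k`, `v` odd). [folklore] -/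
theorem velShape_gap_min {ω₂ : ℝ} (hω : 0 < ω₂) {d₂ : ℝ} (hd₂ : 0 < d₂) :
    ∃ d₁ : ℝ, 0 < d₁ ∧ ∃ γ : ℝ, 0 < γ ∧ ∀ u w : ℝ, |u + kappaStar ω₂| ≤ d₁ →
      w ∈ Icc (-π - 1) (π + 1) → d₂ ≤ |w + kappaStar ω₂| →
      groupVelocity ω₂ u + γ ≤ groupVelocity ω₂ w := by
  obtain ⟨d₁, hd₁, γ, hγ, h⟩ := velShape_gap_max hω hd₂
  refine ⟨d₁, hd₁, γ, hγ, fun u w hu hw hfar => ?_⟩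
  have h1 := h (-u) (-w) (by rwa [show -u - kappaStar ω₂ = -(u + kappaStar ω₂) by ring, abs_neg])
    ⟨by linarith [hw.2], by linarith [hw.1]⟩
    (by rwa [show -w - kappaStar ω₂ = -(w + kappaStar ω₂) by ring, abs_neg])
  rw [groupVelocity_neg, groupVelocity_neg] at h1
  linarith

/-! ### Floors for `|v′|` away from `±κ*` -/

/-- `v′` is continuous. [folklore] -/
theorem velShape_continuous_deriv {ω₂ : ℝ} (hω : 0 < ω₂) : Continuous (deriv (groupVelocity ω₂)) := by
  have : deriv (groupVelocity ω₂) =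
      fun k => ((ω₂ + 2) * cos k - cos k ^ 2 - 1) / dispersion ω₂ k ^ 3 :=
    funext (velShape_deriv_eq hω)
  rw [this]
  have hd : Continuous fun k => dispersion ω₂ k := by unfold dispersion; fun_prop
  exact Continuous.div (by fun_prop) (hd.pow 3) fun k => (pow_pos (dispersion_pos hω k) 3).ne'

/-- Floor on the increasing arc: `v′ ≥ c > 0` on `[−κ* + d, κ* − d]` (`d > 0`). [folklore] -/
theorem velShape_deriv_floor_inc {ω₂ : ℝ} (hω : 0 < ω₂) {d : ℝ} (hd : 0 < d) :
    ∃ c : ℝ, 0 < c ∧ ∀ k ∈ Icc (-kappaStar ω₂ + d) (kappaStar ω₂ - d),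
      c ≤ deriv (groupVelocity ω₂) k := by
  set S := Icc (-kappaStar ω₂ + d) (kappaStar ω₂ - d)
  have hpos : ∀ k ∈ S, 0 < deriv (groupVelocity ω₂) k := fun k hk =>
    velShape_deriv_pos_of_cos_gt hω (velShape_cos_gt_of_abs_lt hω (abs_lt.2 ⟨by linarith [hk.1], by linarith [hk.2]⟩))
  by_cases hS : S.Nonempty
  · obtain ⟨k₀, hk₀, hmin⟩ := isCompact_Icc.exists_isMinOn hS (velShape_continuous_deriv hω).continuousOn
    exact ⟨_, hpos k₀ hk₀, fun k hk => hmin hk⟩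
  · exact ⟨1, one_pos, fun k hk => absurd ⟨k, hk⟩ hS⟩

/-- Floor on the decreasing arc: `v′ ≤ −c < 0` on `[κ* + d, 2π − κ* − d]` (`d > 0`). [folklore] -/
theorem velShape_deriv_floor_dec {ω₂ : ℝ} (hω : 0 < ω₂) {d : ℝ} (hd : 0 < d) :
    ∃ c : ℝ, 0 < c ∧ ∀ k ∈ Icc (kappaStar ω₂ + d) (2 * π - kappaStar ω₂ - d),
      deriv (groupVelocity ω₂) k ≤ -c := by
  set S := Icc (kappaStar ω₂ + d) (2 * π - kappaStar ω₂ - d)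
  have hneg : ∀ k ∈ S, deriv (groupVelocity ω₂) k < 0 := fun k hk =>
    velShape_deriv_neg_of_cos_lt hω (velShape_cos_lt_of_mem hω ⟨by linarith [hk.1], by linarith [hk.2]⟩)
  by_cases hS : S.Nonempty
  · obtain ⟨k₀, hk₀, hmax⟩ := isCompact_Icc.exists_isMaxOn hS (velShape_continuous_deriv hω).continuousOn
    refine ⟨-deriv (groupVelocity ω₂) k₀, by linarith [hneg k₀ hk₀], fun k hk => ?_⟩
    have := (isMaxOn_iff.1 hmax) k hk
    linarith
  · exact ⟨1, one_pos, fun k hk => absurd ⟨k, hk⟩ hS⟩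

/-- `v′` is `2π`-periodic. [folklore] -/
theorem velShape_deriv_periodic (ω₂ : ℝ) : Function.Periodic (deriv (groupVelocity ω₂)) (2 * π) := by
  intro k
  have h : groupVelocity ω₂ = fun x => groupVelocity ω₂ (x + 2 * π) :=
    funext fun x => ((groupVelocity_periodic ω₂) x).symm
  conv_rhs => rw [h]
  rw [deriv_comp_add_const]

/-! ### The second derivative -/

/-- **`v″(k) = −sin k·(cos²k − (ω₂+2)cos k + (ω₂+2)² − 3)/ω⁵`.** [folklore] -/
theorem velShape_hasDerivAt_deriv {ω₂ : ℝ} (hω : 0 < ω₂) (k : ℝ) :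
    HasDerivAt (deriv (groupVelocity ω₂))
      (-sin k * (cos k ^ 2 - (ω₂ + 2) * cos k + (ω₂ + 2) ^ 2 - 3) / dispersion ω₂ k ^ 5) k := by
  have hfun : deriv (groupVelocity ω₂) =
      fun k => ((ω₂ + 2) * cos k - cos k ^ 2 - 1) / dispersion ω₂ k ^ 3 :=
    funext (velShape_deriv_eq hω)
  rw [hfun]
  have hω0 : dispersion ω₂ k ≠ 0 := (dispersion_pos hω k).ne'
  have hnum : HasDerivAt (fun k => (ω₂ + 2) * cos k - cos k ^ 2 - 1)
      (-(ω₂ + 2) * sin k + 2 * cos k * sin k) k := by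
    have h1 := ((hasDerivAt_cos k).const_mul (ω₂ + 2))
    have h2 := (hasDerivAt_cos k).pow 2
    have h := (h1.sub h2).sub_const 1
    refine h.congr_deriv ?_
    norm_num
    try ring
  have hden : HasDerivAt (fun k => dispersion ω₂ k ^ 3)
      (3 * groupVelocity ω₂ k * dispersion ω₂ k ^ 2) k := by
    have h := (hasDerivAt_dispersion hω k).pow 3
    refine h.congr_deriv ?_
    norm_num
    try ring
  have h := hnum.div hden (pow_ne_zero 3 hω0)
  refine h.congr_deriv ?_
  have hsq := dispersion_sq hω.le k
  unfold groupVelocity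
  field_simp
  rw [hsq]
  ring

/-- The bracket `cos²k − (ω₂+2)cos k + (ω₂+2)² − 3` is at least `(3/4)(ω₂+2)² − 3 > 0`. [folklore] -/
theorem velShape_bracket_pos {ω₂ : ℝ} (hω : 0 < ω₂) (k : ℝ) :
    3 / 4 * (ω₂ + 2) ^ 2 - 3 ≤ cos k ^ 2 - (ω₂ + 2) * cos k + (ω₂ + 2) ^ 2 - 3 ∧
      0 < 3 / 4 * (ω₂ + 2) ^ 2 - 3 := by
  constructor
  · nlinarith [sq_nonneg (cos k - (ω₂ + 2) / 2)]
  · nlinarith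

/-- `v″ < 0` on `(0, π)`. [folklore] -/
theorem velShape_deriv2_neg {ω₂ : ℝ} (hω : 0 < ω₂) {k : ℝ} (hk : k ∈ Ioo 0 π) :
    deriv (deriv (groupVelocity ω₂)) k < 0 := by
  rw [(velShape_hasDerivAt_deriv hω k).deriv]
  have hb := velShape_bracket_pos hω k
  have hs : 0 < sin k := sin_pos_of_pos_of_lt_pi hk.1 hk.2
  have hd : 0 < dispersion ω₂ k ^ 5 := pow_pos (dispersion_pos hω k) 5
  apply div_neg_of_neg_of_pos _ hd
  have : 0 < cos k ^ 2 - (ω₂ + 2) * cos k + (ω₂ + 2) ^ 2 - 3 := by linarith [hb.1, hb.2]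
  nlinarith

/-- `v″` is continuous. [folklore] -/
theorem velShape_continuous_deriv2 {ω₂ : ℝ} (hω : 0 < ω₂) :
    Continuous (deriv (deriv (groupVelocity ω₂))) := by
  have : deriv (deriv (groupVelocity ω₂)) = fun k =>
      -sin k * (cos k ^ 2 - (ω₂ + 2) * cos k + (ω₂ + 2) ^ 2 - 3) / dispersion ω₂ k ^ 5 :=
    funext fun k => (velShape_hasDerivAt_deriv hω k).deriv
  rw [this]
  have hd : Continuous fun k => dispersion ω₂ k := by unfold dispersion; fun_prop
  exact Continuous.div (by fun_prop) (hd.pow 5) fun k => (pow_pos (dispersion_pos hω k) 5).ne'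

/-- Floor for `−v″` near the maximum: `v″ ≤ −c_J < 0` on `[κ*/2, (κ* + π)/2]`. [folklore] -/
theorem velShape_deriv2_floor_max {ω₂ : ℝ} (hω : 0 < ω₂) :
    ∃ c : ℝ, 0 < c ∧ ∀ k ∈ Icc (kappaStar ω₂ / 2) ((kappaStar ω₂ + π) / 2),
      deriv (deriv (groupVelocity ω₂)) k ≤ -c := by
  have hκ := velShape_kappaStar_mem hω
  set S := Icc (kappaStar ω₂ / 2) ((kappaStar ω₂ + π) / 2)
  have hS : S.Nonempty := ⟨kappaStar ω₂, by constructor <;> linarith [hκ.1, hκ.2]⟩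
  have hneg : ∀ k ∈ S, deriv (deriv (groupVelocity ω₂)) k < 0 := fun k hk =>
    velShape_deriv2_neg hω ⟨by linarith [hk.1, hκ.1], by linarith [hk.2, hκ.2]⟩
  obtain ⟨k₀, hk₀, hmax⟩ := isCompact_Icc.exists_isMaxOn hS (velShape_continuous_deriv2 hω).continuousOn
  refine ⟨-deriv (deriv (groupVelocity ω₂)) k₀, by linarith [hneg k₀ hk₀], fun k hk => ?_⟩
  have := (isMaxOn_iff.1 hmax) k hk
  linarith

/-- `v″` is odd (since `v` is odd). [folklore] -/
theorem velShape_deriv2_neg_arg {ω₂ : ℝ} (hω : 0 < ω₂) (k : ℝ) :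
    deriv (deriv (groupVelocity ω₂)) (-k) = -deriv (deriv (groupVelocity ω₂)) k := by
  rw [(velShape_hasDerivAt_deriv hω k).deriv, (velShape_hasDerivAt_deriv hω (-k)).deriv,
    Real.sin_neg, Real.cos_neg, dispersion_neg]
  ring

/-- Floor for `v″` near the minimum: `v″ ≥ c_J > 0` on `[−(κ* + π)/2, −κ*/2]`. [folklore] -/
theorem velShape_deriv2_floor_min {ω₂ : ℝ} (hω : 0 < ω₂) :
    ∃ c : ℝ, 0 < c ∧ ∀ k ∈ Icc (-((kappaStar ω₂ + π) / 2)) (-(kappaStar ω₂ / 2)),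
      c ≤ deriv (deriv (groupVelocity ω₂)) k := by
  obtain ⟨c, hc, h⟩ := velShape_deriv2_floor_max hω
  refine ⟨c, hc, fun k hk => ?_⟩
  have h1 := h (-k) ⟨by linarith [hk.2], by linarith [hk.1]⟩
  rw [velShape_deriv2_neg_arg hω] at h1
  linarith

end Summit.AtomisticToContinuum.FouriersLaw.Theorems.MourreDissolution
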